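import Summits.ResolutionOfSingularities.ResolutionOfSingularities.Theorems.FrobeniusLadderFInjectiveMacaulayficationF108ToricMW

/-!
# [OURS · L1 W4.5a · F-108 toric infrastructure 7/8] The exponent tables `KA`, `A` of a good state and their properties

From a state `S` with `Inv S`: the 𝔪-quotient vertices `κ_d = m_d − e_{l_d}`, the polyhedron `P_g` of the quotient support function
(`MemPg`), the table `KA = {κ_d} ∪ {κ_d + w_d i : membership disjunct} ∪ {N' e_l}` and `A = {e_j + κ : κ ∈ KA}` (as finite sets of
vectors of `ℤⁿ`, all nonnegative), with the combinatorial content of the binder block of `F108Consumable`: `hm` (`m_d ∈ A`), `haA`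
(`m_d + w_d i ∈ A`), `hge` (the vertex `m_d` minimises every ray of `d` over `A`), `hprim`/`hKprim`/`hAJ` (pure powers, no zero
exponent), and ★ `AA_cover` (the Rees cover certificate `D·e ≥ Σ μ̂ m`, `μ̂_{d₀} ≥ 1`, from file 6/8).
AI-written; weaker than expert review. Nothing here proves resolution of singularities in positive characteristic.
-/

set_option linter.dupNamespace false

noncomputable section

namespace Summit.ResolutionOfSingularities.ResolutionOfSingularities.Theorems.FInjectiveMacaulayfication.F108Toric

open Matrix Finset

variable {n : ℕ}

/-- The vertex of the 𝔪-quotient polyhedron on the cone `d`: `κ_d = m_d − e_{l_d}`. [OURS · bookkeeping] -/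
def kap (d : DCone n) : Fin n → ℤ := d.m - Pi.single d.l 1

/-- Membership in the polyhedron of the 𝔪-quotient support function: `⟨ρ, x⟩ ≥ ⟨ρ, κ_d⟩` for every ray `ρ` of every cone `d`.
[OURS · bookkeeping] -/
def MemPg (S : Finset (DCone n)) (x : Fin n → ℤ) : Prop := ∀ d ∈ S, ∀ j, d.ray j ⬝ᵥ kap d ≤ d.ray j ⬝ᵥ x

/-- The first disjunct of neighbour membership (decidable data for the table). [OURS · bookkeeping] -/
def Amem1 (S : Finset (DCone n)) (d : DCone n) (i : Fin n) : Prop :=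
  ∀ d'' ∈ S, ∀ j, d''.ray j d.l - d''.ray j d''.l ≤ d''.ray j ⬝ᵥ (d.m + d.w i - d''.m)

open Classical in
/-- The exponent `N'` of the pure powers put into `KA`: one more than `max |⟨ρ, κ_d⟩|`. [OURS · bookkeeping] -/
def bigN (S : Finset (DCone n)) : ℤ := 1 + (((S ×ˢ (univ : Finset (Fin n))).sup fun p => (p.1.ray p.2 ⬝ᵥ kap p.1).natAbs : ℕ) : ℤ)

open Classical in
/-- The table `KA`. [OURS · bookkeeping] -/
def KA (S : Finset (DCone n)) : Finset (Fin n → ℤ) :=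
  S.image kap ∪ ((S ×ˢ (univ : Finset (Fin n))).filter (fun p => Amem1 S p.1 p.2)).image (fun p => kap p.1 + p.1.w p.2) ∪
    univ.image (fun l : Fin n => bigN S • (Pi.single l 1 : Fin n → ℤ))

open Classical in
/-- The table `A = 𝔪 · KA = {e_j + κ}`. [OURS · bookkeeping] -/
def AA (S : Finset (DCone n)) : Finset (Fin n → ℤ) :=
  ((univ : Finset (Fin n)) ×ˢ KA S).image fun p => (Pi.single p.1 1 : Fin n → ℤ) + p.2

/-- Membership in `AA`. -/
theorem mem_AA {S : Finset (DCone n)} {e : Fin n → ℤ} : e ∈ AA S ↔ ∃ j, ∃ κ ∈ KA S, e = Pi.single j 1 + κ := by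
  classical
  unfold AA
  simp only [mem_image, mem_product, mem_univ, true_and, Prod.exists]
  constructor
  · rintro ⟨j, κ, hκ, rfl⟩; exact ⟨j, κ, hκ, rfl⟩
  · rintro ⟨j, κ, hκ, rfl⟩; exact ⟨j, κ, hκ, rfl⟩

/-- `e_j + κ ∈ AA` for `κ ∈ KA`. -/
theorem single_add_mem_AA {S : Finset (DCone n)} (j : Fin n) {κ : Fin n → ℤ} (hκ : κ ∈ KA S) : Pi.single j 1 + κ ∈ AA S :=
  mem_AA.2 ⟨j, κ, hκ, rfl⟩

section tables

variable {S : Finset (DCone n)} (hS : Inv S)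
include hS

/-- `κ_d ≥ 0`. -/
theorem Inv.kap_nonneg {d : DCone n} (hd : d ∈ S) (j : Fin n) : 0 ≤ kap d j := by
  unfold kap
  rw [Pi.sub_apply, Pi.single_apply]
  have := hS.mnonneg d hd j
  have := hS.mlpos d hd
  split_ifs with h
  · subst h; omega
  · omega

/-- `κ_d ∈ P_g` (𝔪-domination). -/
theorem Inv.memPg_kap {d : DCone n} (hd : d ∈ S) : MemPg S (kap d) := by
  intro d'' hd'' j
  unfold kap
  rw [dotProduct_sub, dotProduct_sub, dotProduct_single, dotProduct_single, mul_one, mul_one]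
  have := hS.dom d'' hd'' d hd j
  rw [dotProduct_sub] at this
  linarith

omit hS in
/-- `κ_d + w_d i ∈ P_g` in the membership disjunct. -/
theorem memPg_kap_add_w {d : DCone n} {i : Fin n} (h1 : Amem1 S d i) : MemPg S (kap d + d.w i) := by
  intro d'' hd'' j
  unfold kap
  have := h1 d'' hd'' j
  rw [dotProduct_sub, dotProduct_add] at this
  rw [dotProduct_sub, dotProduct_add, dotProduct_sub, dotProduct_single, dotProduct_single, mul_one, mul_one]
  linarith

/-- `N' e_l ∈ P_g`. -/
theorem Inv.memPg_bigN (l : Fin n) : MemPg S (bigN S • (Pi.single l 1 : Fin n → ℤ)) := by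
  classical
  intro d'' hd'' j
  rw [dotProduct_smul, dotProduct_single, mul_one, smul_eq_mul]
  have hB : (d''.ray j ⬝ᵥ kap d'' : ℤ) ≤ bigN S - 1 := by
    have hmem : (d'', j) ∈ S ×ˢ (univ : Finset (Fin n)) := mem_product.2 ⟨hd'', mem_univ j⟩
    have h1 : (d''.ray j ⬝ᵥ kap d'').natAbs ≤ (S ×ˢ (univ : Finset (Fin n))).sup fun p => (p.1.ray p.2 ⬝ᵥ kap p.1).natAbs :=
      le_sup (f := fun p : DCone n × Fin n => (p.1.ray p.2 ⬝ᵥ kap p.1).natAbs) hmem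
    have h2 : (d''.ray j ⬝ᵥ kap d'' : ℤ) ≤ ((d''.ray j ⬝ᵥ kap d'').natAbs : ℤ) := by
      rw [Int.natCast_natAbs]; exact le_abs_self _
    have h3 : ((d''.ray j ⬝ᵥ kap d'').natAbs : ℤ) ≤
        (((S ×ˢ (univ : Finset (Fin n))).sup fun p => (p.1.ray p.2 ⬝ᵥ kap p.1).natAbs : ℕ) : ℤ) := by exact_mod_cast h1
    unfold bigN; linarith
  have hN1 : 1 ≤ bigN S := by unfold bigN; have := Nat.cast_nonneg (α := ℤ) ((S ×ˢ (univ : Finset (Fin n))).sup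
    fun p => (p.1.ray p.2 ⬝ᵥ kap p.1).natAbs); linarith
  by_cases hz : ∃ k, d''.ray j k = 0
  · -- a boundary ray: the support function vanishes, `⟨ρ, κ⟩ = −ρ_l ≤ 0`
    have h0 := hS.bdry d'' hd'' j hz
    unfold kap
    rw [dotProduct_sub, h0, dotProduct_single, mul_one]
    have := hS.nonneg d'' hd'' j l
    have := hS.nonneg d'' hd'' j d''.l
    nlinarith
  · -- an interior ray: `ρ_l ≥ 1`
    have h1 : 1 ≤ d''.ray j l := by
      have := hS.nonneg d'' hd'' j l
      by_contra hlt; exact hz ⟨l, by omega⟩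
    nlinarith

/-- Points of `P_g` are nonnegative (read at the coordinate rays). -/
theorem Inv.memPg_nonneg {x : Fin n → ℤ} (hx : MemPg S x) (j : Fin n) : 0 ≤ x j := by
  obtain ⟨d'', hd'', i'', hi''⟩ := hS.exists_ray_eq_single j
  have h := hx d'' hd'' i''
  rw [hi'', single_dotProduct, single_dotProduct, one_mul, one_mul] at h
  exact le_trans (hS.kap_nonneg hd'' j) h

omit hS in
/-- Membership in `KA`. -/
theorem mem_KA_iff {κ : Fin n → ℤ} : κ ∈ KA S ↔ (∃ d ∈ S, κ = kap d) ∨ (∃ d ∈ S, ∃ i, Amem1 S d i ∧ κ = kap d + d.w i) ∨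
    ∃ l : Fin n, κ = bigN S • (Pi.single l 1 : Fin n → ℤ) := by
  classical
  unfold KA
  simp only [mem_union, mem_image, mem_filter, mem_product, mem_univ, and_true, true_and, Prod.exists]
  constructor
  · rintro ((⟨d, hd, rfl⟩ | ⟨d, i, ⟨hd, h1⟩, rfl⟩) | ⟨l, rfl⟩)
    · exact Or.inl ⟨d, hd, rfl⟩
    · exact Or.inr (Or.inl ⟨d, hd, i, h1, rfl⟩)
    · exact Or.inr (Or.inr ⟨l, rfl⟩)
  · rintro (⟨d, hd, rfl⟩ | ⟨d, hd, i, h1, rfl⟩ | ⟨l, rfl⟩)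
    · exact Or.inl (Or.inl ⟨d, hd, rfl⟩)
    · exact Or.inl (Or.inr ⟨d, i, ⟨hd, h1⟩, rfl⟩)
    · exact Or.inr ⟨l, rfl⟩

/-- Every element of `KA` lies in `P_g`. -/
theorem Inv.memPg_of_mem_KA {κ : Fin n → ℤ} (hκ : κ ∈ KA S) : MemPg S κ := by
  rcases mem_KA_iff.1 hκ with ⟨d, hd, rfl⟩ | ⟨d, hd, i, h1, rfl⟩ | ⟨l, rfl⟩
  · exact hS.memPg_kap hd
  · exact memPg_kap_add_w h1
  · exact hS.memPg_bigN l

/-- Every element of `KA` is nonnegative. -/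
theorem Inv.KA_nonneg {κ : Fin n → ℤ} (hκ : κ ∈ KA S) (j : Fin n) : 0 ≤ κ j := hS.memPg_nonneg (hS.memPg_of_mem_KA hκ) j

/-- Every element of `AA` is nonnegative. -/
theorem Inv.AA_nonneg {e : Fin n → ℤ} (he : e ∈ AA S) (j : Fin n) : 0 ≤ e j := by
  obtain ⟨j', κ, hκ, rfl⟩ := mem_AA.1 he
  rw [Pi.add_apply, Pi.single_apply]
  have := hS.KA_nonneg hκ j
  split_ifs <;> omega

/-- `hAJ`: every element of `AA` has a positive coordinate. -/
theorem Inv.AA_exists_pos {e : Fin n → ℤ} (he : e ∈ AA S) : ∃ j, 0 < e j := by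
  obtain ⟨j, κ, hκ, rfl⟩ := mem_AA.1 he
  refine ⟨j, ?_⟩
  rw [Pi.add_apply, Pi.single_eq_same]
  have := hS.KA_nonneg hκ j
  omega

omit hS in
/-- `hKprim`: `KA` contains the pure power `N' e_l`. -/
theorem bigN_single_mem_KA (l : Fin n) : bigN S • (Pi.single l 1 : Fin n → ℤ) ∈ KA S :=
  mem_KA_iff.2 (Or.inr (Or.inr ⟨l, rfl⟩))

omit hS in
/-- `hprim`: `AA` contains the pure power `(N' + 1) e_l`. -/
theorem succ_single_mem_AA (l : Fin n) : Pi.single l 1 + bigN S • (Pi.single l 1 : Fin n → ℤ) ∈ AA S :=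
  single_add_mem_AA l (bigN_single_mem_KA l)

omit hS in
/-- `hm`: the vertex `m_d = e_{l_d} + κ_d` belongs to `AA`. -/
theorem m_mem_AA {d : DCone n} (hd : d ∈ S) : d.m ∈ AA S := by
  have : d.m = Pi.single d.l 1 + kap d := by unfold kap; abel
  rw [this]; exact single_add_mem_AA d.l (mem_KA_iff.2 (Or.inl ⟨d, hd, rfl⟩))

/-- `haA`: the neighbour `m_d + w_d i` belongs to `AA`. -/
theorem Inv.m_add_w_mem_AA {d : DCone n} (hd : d ∈ S) (i : Fin n) : d.m + d.w i ∈ AA S := by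
  rcases hS.amem d hd i with h1 | ⟨j', hj'⟩
  · have : d.m + d.w i = Pi.single d.l 1 + (kap d + d.w i) := by unfold kap; abel
    rw [this]; exact single_add_mem_AA d.l (mem_KA_iff.2 (Or.inr (Or.inl ⟨d, hd, i, h1, rfl⟩)))
  · have : d.m + d.w i = Pi.single j' 1 + kap d := by rw [hj']; unfold kap; abel
    rw [this]; exact single_add_mem_AA j' (mem_KA_iff.2 (Or.inl ⟨d, hd, rfl⟩))

/-- `hge`: the vertex `m_d` minimises every ray of `d` over `AA`. -/
theorem Inv.AA_ge {e : Fin n → ℤ} (he : e ∈ AA S) {d : DCone n} (hd : d ∈ S) (i : Fin n) : d.ray i ⬝ᵥ d.m ≤ d.ray i ⬝ᵥ e := by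
  obtain ⟨j, κ, hκ, rfl⟩ := mem_AA.1 he
  have h1 := hS.memPg_of_mem_KA hκ d hd i
  unfold kap at h1
  rw [dotProduct_sub, dotProduct_single, mul_one] at h1
  rw [dotProduct_add, dotProduct_single, mul_one]
  have := hS.lmin d hd i j
  linarith

/-- `hgen`: `⟨ray_j, m_d + w_d i⟩ = ⟨ray_j, m_d⟩ + δᵢⱼ`. -/
theorem Inv.ray_dot_m_add_w {d : DCone n} (hd : d ∈ S) (i j : Fin n) :
    d.ray j ⬝ᵥ (d.m + d.w i) = d.ray j ⬝ᵥ d.m + if i = j then 1 else 0 := by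
  rw [dotProduct_add, hS.dual d hd]

/-- ★ `hcov`: every element of `AA` has a Rees cover certificate at some vertex chart. -/
theorem Inv.AA_cover {e : Fin n → ℤ} (he : e ∈ AA S) :
    ∃ d₀ ∈ S, ∃ D : ℕ, ∃ μ : DCone n → ℕ, 1 ≤ μ d₀ ∧ ∑ d ∈ S, μ d = D ∧ ∀ j, ∑ d ∈ S, (μ d : ℤ) * d.m j ≤ (D : ℤ) * e j := by
  obtain ⟨D, μ, hD, hsum, hle⟩ := hS.mw_int e fun d hd i => hS.AA_ge he hd i
  have : ∃ d₀ ∈ S, 1 ≤ μ d₀ := by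
    by_contra hno
    have h0 : ∀ d ∈ S, μ d = 0 := fun d hd => by
      by_contra hne; exact hno ⟨d, hd, Nat.one_le_iff_ne_zero.2 hne⟩
    rw [sum_eq_zero h0] at hsum
    omega
  obtain ⟨d₀, hd₀, h1⟩ := this
  exact ⟨d₀, hd₀, D, μ, h1, hsum, hle⟩

end tables

end Summit.ResolutionOfSingularities.ResolutionOfSingularities.Theorems.FInjectiveMacaulayfication.F108Toric

end
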